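import Mathlib.NumberTheory.Zsqrtd.Basic
import Mathlib.Tactic.IntervalCases
import Mathlib.Tactic.Linarith
import Mathlib.Tactic.Ring
import HarnessLib

/-!
# The two-squares system of residues modulo `a + bi` and the triangle lemma (Graves 2023, §4)

Topic `Literature/NumberTheory/QuadraticFields`, namespace `Literature.NumberTheory.QuadraticFields.GaussianDigits`
(Gaussian integers = Mathlib's `ℤ√(-1)`).  THEOREMS ONLY (no `def`, no instance, no named fact); everything
PROVED.  Second of three files formalising Graves' paper (`GaussianDigitExpansions.lean` = §2,
`GaussianMinimalEuclideanFunction.lean` = §§3, 5); this one is independent of the other two.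

## Source (read at the page)

H. Graves, *The minimal Euclidean function on the Gaussian integers*, Indag. Math. (N.S.) **34** (2023) 78–88
[Graves2023] (materialised `paper:arxiv-1802.08281`, p. 7), VERBATIM:
* Corollary 4.3: «If `a > b ≥ 0`, if `T = {x+iy : 0 ≤ x < b, −b ≤ y < 0}`, and if `S = {x+yi : 0 ≤ x, y < a}`,
  then `S ∪ T` contains exactly one representative for each coset of `a+bi`.»
* Lemma 4.4: «Let `a > b ≥ 0`, `2 ∤ (a,b)`, and let `𝒮 = {x+yi : 0 ≤ x < a, 0 ≤ y < a − x}`. If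
  `𝒮 ⊂ ⋃_{z ∈ ℤ[i]} (B_n + (a+bi)z)`, then `B_n ↠ ℤ[i]/(a+bi)`.»  Its proof uses only that
  `U = ⋃_z (B_n + (a+bi)z)` «is closed under multiplication by units» and under translation by multiples of
  `a+bi`, and shows `S ∪ T ⊆ U` from `𝒮 ⊆ U` through the five pieces `𝒮`, `−𝒮 + (a+bi)`, `i𝒮 + (a+bi)`,
  `i(−𝒮 + a+bi)`, `−𝒮 + (1+i)(a+bi)` and `T ⊂ −iS`, the two lines `y = x+b`, `y = a−x` meeting only where
  `2x = a − b`, «and `x` cannot be integral».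

## What is formalised, and two deviations from the printed text

* `exists_twoSquares_add_mul` — the existence half of Corollary 4.3: every Gaussian integer is `r + q(a+bi)`
  with `r ∈ S ∪ T` (`S ∪ T` spelled as a disjunction of coordinate inequalities).  The paper obtains this by
  counting (`S ∪ T` has `a² + b² = N(a+bi)` pairwise incongruent elements, Lemmas 4.1–4.2); we prove it
  directly and constructively: `S ∪ T` contains `0` and a unit step from a point of `S ∪ T` lands in `S ∪ T`
  translated by one of `0, ±β, ±iβ, ±(1+i)β` (`β = a+bi`; this is the periodicity of the Pythagorean tiling
  of the plane by the squares `S` and `T`), so the set of representable points is all of `ℤ[i]` by induction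
  along the axes.  The UNIQUENESS half («exactly one»; Lemmas 4.1–4.2) is `eq_of_twoSquares_of_dvd_sub`
  (§4), proved as printed through `N(z)·N(a+bi) = (α−c)² + (β−d)² < 4N(a+bi)`, so `z` has coordinates in
  `{0, ±1}` and the eight translates miss; together `existsUnique_twoSquares` is Corollary 4.3 verbatim.
* `mem_of_twoSquares_of_triangle_subset` (Lemma 4.4, core: `𝒮 ⊆ U ⇒ S ∪ T ⊆ U` for any `U` closed under
  `u ↦ iu` and `u ↦ u + q(a+bi)`), `forall_mem_of_triangle_subset` (`⇒ U = ℤ[i]`) and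
  `forall_exists_dvd_sub_of_triangle` (Lemma 4.4 as printed, for an arbitrary unit-stable set `B` in place of
  `B_n`: if every point of `𝒮` is congruent mod `a+bi` to an element of `B`, so is every Gaussian integer).
  The printed hypothesis «`2 ∤ (a,b)`» is used in the proof only through «`2x = a − b` … `x` cannot be
  integral», i.e. through `a ≢ b (mod 2)`; we assume exactly that (`¬ 2 ∣ a + b`), which is what §5 supplies
  (`(1+i) ∤ a+bi`).  (For `a ≡ b ≡ 1 (mod 2)` the printed argument does not cover the point
  `((a−b)/2, (a+b)/2)`.)

## Mathlib / tree search

Mathlib: `Zsqrtd.ext`, `re_mul`, `im_mul`, `Int.induction_on`; no residue systems for `ℤ√d`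
(`lean search 'Zsqrtd.*(resid|repr|coset)'`: none).  Tree: `ImaginaryQuadraticUniversalSideDivisors.lean`
(explicit residues mod `1+i`, `2+i`); nothing general.
-/

namespace Literature.NumberTheory.QuadraticFields.GaussianDigits

open _root_.Zsqrtd

/-! ## §1 The Pythagorean tiling: unit steps from `S ∪ T` -/

section Steps

variable {a b : ℤ}

/-- A step `+1` from `S ∪ T` lands in `(S ∪ T) + {0, β, −iβ}`. [cite: Graves2023, Cor. 4.3 (p. 7)] -/
private theorem step_right (hab : b < a) (hb : 0 ≤ b) {x y : ℤ}
    (h : (0 ≤ x ∧ x < a ∧ 0 ≤ y ∧ y < a) ∨ (0 ≤ x ∧ x < b ∧ -b ≤ y ∧ y < 0)) :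
    ∃ x' y' m k : ℤ, ((0 ≤ x' ∧ x' < a ∧ 0 ≤ y' ∧ y' < a) ∨ (0 ≤ x' ∧ x' < b ∧ -b ≤ y' ∧ y' < 0)) ∧
      x + 1 = x' + (m * a - k * b) ∧ y = y' + (m * b + k * a) := by
  rcases h with ⟨h1, h2, h3, h4⟩ | ⟨h1, h2, h3, h4⟩
  · by_cases hx : x + 1 < a
    · exact ⟨x + 1, y, 0, 0, Or.inl ⟨by omega, hx, h3, h4⟩, by ring, by ring⟩
    · -- right edge of `S`: subtract `β`
      refine ⟨0, y - b, 1, 0, ?_, by omega, by ring⟩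
      by_cases hy : b ≤ y
      · exact Or.inl ⟨le_rfl, by omega, by omega, by omega⟩
      · exact Or.inr ⟨le_rfl, by omega, by omega, by omega⟩
  · by_cases hx : x + 1 < b
    · exact ⟨x + 1, y, 0, 0, Or.inr ⟨by omega, hx, h3, h4⟩, by ring, by ring⟩
    · -- right edge of `T`: subtract `−iβ = (b, −a)`
      exact ⟨0, y + a, 0, -1, Or.inl ⟨le_rfl, by omega, by omega, by omega⟩, by omega, by ring⟩

/-- A step `−1` from `S ∪ T` lands in `(S ∪ T) + {0, −β, iβ}`. [cite: Graves2023, Cor. 4.3 (p. 7)] -/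
private theorem step_left (hab : b < a) (hb : 0 ≤ b) {x y : ℤ}
    (h : (0 ≤ x ∧ x < a ∧ 0 ≤ y ∧ y < a) ∨ (0 ≤ x ∧ x < b ∧ -b ≤ y ∧ y < 0)) :
    ∃ x' y' m k : ℤ, ((0 ≤ x' ∧ x' < a ∧ 0 ≤ y' ∧ y' < a) ∨ (0 ≤ x' ∧ x' < b ∧ -b ≤ y' ∧ y' < 0)) ∧
      x - 1 = x' + (m * a - k * b) ∧ y = y' + (m * b + k * a) := by
  rcases h with ⟨h1, h2, h3, h4⟩ | ⟨h1, h2, h3, h4⟩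
  · by_cases hx : 1 ≤ x
    · exact ⟨x - 1, y, 0, 0, Or.inl ⟨by omega, by omega, h3, h4⟩, by ring, by ring⟩
    · -- left edge of `S`
      by_cases hy : y < a - b
      · -- add `β`: the point `(a − 1, y + b)` of `S`
        exact ⟨a - 1, y + b, -1, 0, Or.inl ⟨by omega, by omega, by omega, by omega⟩, by omega, by ring⟩
      · -- subtract `iβ = (−b, a)`: the point `(b − 1, y − a)` of `T`
        exact ⟨b - 1, y - a, 0, 1, Or.inr ⟨by omega, by omega, by omega, by omega⟩, by omega, by ring⟩
  · by_cases hx : 1 ≤ x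
    · exact ⟨x - 1, y, 0, 0, Or.inr ⟨by omega, by omega, h3, h4⟩, by ring, by ring⟩
    · -- left edge of `T`: add `β`
      exact ⟨a - 1, y + b, -1, 0, Or.inl ⟨by omega, by omega, by omega, by omega⟩, by omega, by ring⟩

/-- A step `+i` from `S ∪ T` lands in `(S ∪ T) + {0, iβ, (1+i)β}`. [cite: Graves2023, Cor. 4.3 (p. 7)] -/
private theorem step_up (hab : b < a) (hb : 0 ≤ b) {x y : ℤ}
    (h : (0 ≤ x ∧ x < a ∧ 0 ≤ y ∧ y < a) ∨ (0 ≤ x ∧ x < b ∧ -b ≤ y ∧ y < 0)) :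
    ∃ x' y' m k : ℤ, ((0 ≤ x' ∧ x' < a ∧ 0 ≤ y' ∧ y' < a) ∨ (0 ≤ x' ∧ x' < b ∧ -b ≤ y' ∧ y' < 0)) ∧
      x = x' + (m * a - k * b) ∧ y + 1 = y' + (m * b + k * a) := by
  rcases h with ⟨h1, h2, h3, h4⟩ | ⟨h1, h2, h3, h4⟩
  · by_cases hy : y + 1 < a
    · exact ⟨x, y + 1, 0, 0, Or.inl ⟨h1, h2, by omega, hy⟩, by ring, by ring⟩
    · -- top edge of `S`
      by_cases hx : x < a - b
      · -- subtract `iβ = (−b, a)`: the point `(x + b, 0)` of `S`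
        exact ⟨x + b, 0, 0, 1, Or.inl ⟨by omega, by omega, le_rfl, by omega⟩, by ring, by omega⟩
      · -- subtract `(1+i)β = (a − b, a + b)`: the point `(x − a + b, −b)` of `T`
        exact ⟨x - a + b, -b, 1, 1, Or.inr ⟨by omega, by omega, le_rfl, by omega⟩, by ring, by omega⟩
  · by_cases hy : y + 1 < 0
    · exact ⟨x, y + 1, 0, 0, Or.inr ⟨h1, h2, by omega, hy⟩, by ring, by ring⟩
    · -- top edge of `T`: into `S`
      exact ⟨x, 0, 0, 0, Or.inl ⟨h1, by omega, le_rfl, by omega⟩, by ring, by omega⟩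

/-- A step `−i` from `S ∪ T` lands in `(S ∪ T) + {0, −iβ, −(1+i)β}`. [cite: Graves2023, Cor. 4.3 (p. 7)] -/
private theorem step_down (hab : b < a) (hb : 0 ≤ b) {x y : ℤ}
    (h : (0 ≤ x ∧ x < a ∧ 0 ≤ y ∧ y < a) ∨ (0 ≤ x ∧ x < b ∧ -b ≤ y ∧ y < 0)) :
    ∃ x' y' m k : ℤ, ((0 ≤ x' ∧ x' < a ∧ 0 ≤ y' ∧ y' < a) ∨ (0 ≤ x' ∧ x' < b ∧ -b ≤ y' ∧ y' < 0)) ∧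
      x = x' + (m * a - k * b) ∧ y - 1 = y' + (m * b + k * a) := by
  rcases h with ⟨h1, h2, h3, h4⟩ | ⟨h1, h2, h3, h4⟩
  · by_cases hy : 1 ≤ y
    · exact ⟨x, y - 1, 0, 0, Or.inl ⟨h1, h2, by omega, by omega⟩, by ring, by ring⟩
    · -- bottom edge of `S`
      by_cases hx : x < b
      · -- into `T`
        exact ⟨x, y - 1, 0, 0, Or.inr ⟨h1, hx, by omega, by omega⟩, by ring, by ring⟩
      · -- add `iβ`: the point `(x − b, y − 1 + a)` of `S`
        exact ⟨x - b, y - 1 + a, 0, -1, Or.inl ⟨by omega, by omega, by omega, by omega⟩, by ring, by ring⟩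
  · by_cases hy : -b ≤ y - 1
    · exact ⟨x, y - 1, 0, 0, Or.inr ⟨h1, h2, hy, by omega⟩, by ring, by ring⟩
    · -- bottom edge of `T`: add `(1+i)β`: the point `(x + a − b, a − 1)` of `S`
      exact ⟨x + a - b, a - 1, -1, -1, Or.inl ⟨by omega, by omega, by omega, by omega⟩, by ring, by omega⟩

end Steps

/-! ## §2 Corollary 4.3 (existence): `S ∪ T` represents every class modulo `a + bi` -/

/-- One unit step (`e` with `x`- and `y`-increments `dx, dy ∈ {0, ±1}`, `|dx| + |dy| = 1`) preserves
representability by `S ∪ T` modulo `a+bi`. [cite: Graves2023, Cor. 4.3 (p. 7)] -/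
private theorem representable_step {a b : ℤ} (hab : b < a) (hb : 0 ≤ b) {z e : ℤ√(-1)}
    (he : (e = 1 ∨ e = -1) ∨ (e = ⟨0, 1⟩ ∨ e = ⟨0, -1⟩))
    (hz : ∃ r q : ℤ√(-1), z = r + q * ⟨a, b⟩ ∧
      ((0 ≤ r.re ∧ r.re < a ∧ 0 ≤ r.im ∧ r.im < a) ∨ (0 ≤ r.re ∧ r.re < b ∧ -b ≤ r.im ∧ r.im < 0))) :
    ∃ r q : ℤ√(-1), z + e = r + q * ⟨a, b⟩ ∧
      ((0 ≤ r.re ∧ r.re < a ∧ 0 ≤ r.im ∧ r.im < a) ∨ (0 ≤ r.re ∧ r.re < b ∧ -b ≤ r.im ∧ r.im < 0)) := by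
  obtain ⟨r, q, rfl, hr⟩ := hz
  obtain ⟨x, y⟩ := r
  dsimp only at hr
  have finish : ∀ x' y' m k : ℤ,
      ((0 ≤ x' ∧ x' < a ∧ 0 ≤ y' ∧ y' < a) ∨ (0 ≤ x' ∧ x' < b ∧ -b ≤ y' ∧ y' < 0)) →
      x + e.re = x' + (m * a - k * b) → y + e.im = y' + (m * b + k * a) →
      ∃ r q' : ℤ√(-1), (⟨x, y⟩ : ℤ√(-1)) + q * ⟨a, b⟩ + e = r + q' * ⟨a, b⟩ ∧
        ((0 ≤ r.re ∧ r.re < a ∧ 0 ≤ r.im ∧ r.im < a) ∨ (0 ≤ r.re ∧ r.re < b ∧ -b ≤ r.im ∧ r.im < 0)) := by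
    intro x' y' m k h hx hy
    refine ⟨⟨x', y'⟩, q + ⟨m, k⟩, Zsqrtd.ext ?_ ?_, h⟩
    · simp only [re_add, re_mul, im_add]; linarith
    · simp only [re_add, im_add, im_mul]; linarith
  rcases he with (rfl | rfl) | (rfl | rfl)
  · obtain ⟨x', y', m, k, h, hx, hy⟩ := step_right hab hb hr
    exact finish x' y' m k h (by simpa using hx) (by simpa using hy)
  · obtain ⟨x', y', m, k, h, hx, hy⟩ := step_left hab hb hr
    exact finish x' y' m k h (by simp; omega) (by simpa using hy)
  · obtain ⟨x', y', m, k, h, hx, hy⟩ := step_up hab hb hr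
    exact finish x' y' m k h (by simpa using hx) (by simpa using hy)
  · obtain ⟨x', y', m, k, h, hx, hy⟩ := step_down hab hb hr
    exact finish x' y' m k h (by simpa using hx) (by simp; omega)

/-- **Corollary 4.3 (existence half)**: for `a > b ≥ 0` every Gaussian integer is congruent modulo `a + bi` to
an element of `S ∪ T`, `S = {x+yi : 0 ≤ x, y < a}`, `T = {x+yi : 0 ≤ x < b, −b ≤ y < 0}` (proved here through
the periodicity of the tiling of the plane by `S` and `T`, not by the printed count). [cite: Graves2023, Cor. 4.3 (p. 7)] -/
theorem exists_twoSquares_add_mul {a b : ℤ} (hab : b < a) (hb : 0 ≤ b) (z : ℤ√(-1)) :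
    ∃ r q : ℤ√(-1), z = r + q * ⟨a, b⟩ ∧
      ((0 ≤ r.re ∧ r.re < a ∧ 0 ≤ r.im ∧ r.im < a) ∨ (0 ≤ r.re ∧ r.re < b ∧ -b ≤ r.im ∧ r.im < 0)) := by
  -- first along the real axis, then along the imaginary direction
  have h0 : ∃ r q : ℤ√(-1), (0 : ℤ√(-1)) = r + q * ⟨a, b⟩ ∧
      ((0 ≤ r.re ∧ r.re < a ∧ 0 ≤ r.im ∧ r.im < a) ∨ (0 ≤ r.re ∧ r.re < b ∧ -b ≤ r.im ∧ r.im < 0)) :=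
    ⟨0, 0, by simp, Or.inl ⟨le_rfl, by simp; omega, le_rfl, by simp; omega⟩⟩
  have hre : ∀ x : ℤ, ∃ r q : ℤ√(-1), ((x : ℤ√(-1))) = r + q * ⟨a, b⟩ ∧
      ((0 ≤ r.re ∧ r.re < a ∧ 0 ≤ r.im ∧ r.im < a) ∨ (0 ≤ r.re ∧ r.re < b ∧ -b ≤ r.im ∧ r.im < 0)) := by
    intro x
    induction x using Int.induction_on with
    | zero => simpa using h0
    | succ i ih =>
      have := representable_step hab hb (e := 1) (Or.inl (Or.inl rfl)) ih
      simpa using this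
    | pred i ih =>
      have := representable_step hab hb (e := -1) (Or.inl (Or.inr rfl)) ih
      simpa [sub_eq_add_neg] using this
  obtain ⟨x, y⟩ := z
  have key : ∀ y : ℤ, ∃ r q : ℤ√(-1), (⟨x, y⟩ : ℤ√(-1)) = r + q * ⟨a, b⟩ ∧
      ((0 ≤ r.re ∧ r.re < a ∧ 0 ≤ r.im ∧ r.im < a) ∨ (0 ≤ r.re ∧ r.re < b ∧ -b ≤ r.im ∧ r.im < 0)) := by
    intro y
    induction y using Int.induction_on with
    | zero => simpa [intCast_val] using hre x
    | succ i ih =>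
      have := representable_step hab hb (e := ⟨0, 1⟩) (Or.inr (Or.inl rfl)) ih
      rwa [show (⟨x, (i : ℤ)⟩ : ℤ√(-1)) + ⟨0, 1⟩ = ⟨x, (i : ℤ) + 1⟩ from Zsqrtd.ext (by simp) (by simp)]
        at this
    | pred i ih =>
      have := representable_step hab hb (e := ⟨0, -1⟩) (Or.inr (Or.inr rfl)) ih
      rwa [show (⟨x, -(i : ℤ)⟩ : ℤ√(-1)) + ⟨0, -1⟩ = ⟨x, -(i : ℤ) - 1⟩ from
        Zsqrtd.ext (by simp) (by simp; ring)] at this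
  exact key y

/-! ## §3 Lemma 4.4: the triangle `𝒮` suffices -/

/-- **Lemma 4.4 (core)**: let `a > b ≥ 0` with `a ≢ b (mod 2)` and let `U` be closed under `u ↦ iu` and
under `u ↦ u + q(a+bi)`.  If the triangle `𝒮 = {x+yi : 0 ≤ x, 0 ≤ y, x+y < a}` lies in `U`, then so does
`S ∪ T`. [cite: Graves2023, Lemma 4.4 (p. 7)] -/
theorem mem_of_twoSquares_of_triangle_subset {a b : ℤ} (hab : b < a) (hb : 0 ≤ b) (hodd : ¬ 2 ∣ a + b)
    {U : Set (ℤ√(-1))} (hUi : ∀ u ∈ U, ⟨0, 1⟩ * u ∈ U) (hUβ : ∀ u ∈ U, ∀ q : ℤ√(-1), u + q * ⟨a, b⟩ ∈ U)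
    (hS : ∀ x y : ℤ, 0 ≤ x → 0 ≤ y → x + y < a → (⟨x, y⟩ : ℤ√(-1)) ∈ U) {r : ℤ√(-1)}
    (hr : (0 ≤ r.re ∧ r.re < a ∧ 0 ≤ r.im ∧ r.im < a) ∨ (0 ≤ r.re ∧ r.re < b ∧ -b ≤ r.im ∧ r.im < 0)) :
    r ∈ U := by
  -- closure of `U` under all four units
  have hUneg : ∀ u ∈ U, -u ∈ U := fun u hu ↦ by
    have h := hUi _ (hUi u hu)
    rwa [← mul_assoc, show (⟨0, 1⟩ * ⟨0, 1⟩ : ℤ√(-1)) = -1 by decide, neg_one_mul] at h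
  have hUnegI : ∀ u ∈ U, ⟨0, -1⟩ * u ∈ U := fun u hu ↦ by
    have h := hUneg _ (hUi u hu)
    rwa [← neg_mul, show (-⟨0, 1⟩ : ℤ√(-1)) = ⟨0, -1⟩ by decide] at h
  -- the square `S`
  have hSq : ∀ x y : ℤ, 0 ≤ x → x < a → 0 ≤ y → y < a → (⟨x, y⟩ : ℤ√(-1)) ∈ U := by
    intro x y hx hxa hy hya
    by_cases h1 : x + y < a
    · exact hS x y hx hy h1
    rcases lt_trichotomy (y - x) b with h2 | h2 | h2
    · by_cases h3 : y ≤ b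
      · -- `p = −s + β`, `s = (a − x, b − y) ∈ 𝒮`
        have hs := hUβ _ (hUneg _ (hS (a - x) (b - y) (by omega) (by omega) (by omega))) 1
        rwa [show (-⟨a - x, b - y⟩ : ℤ√(-1)) + 1 * ⟨a, b⟩ = ⟨x, y⟩ from
          Zsqrtd.ext (by simp) (by simp)] at hs
      · -- `p = i s + β`, `s = (y − b, a − x) ∈ 𝒮`
        have hs := hUβ _ (hUi _ (hS (y - b) (a - x) (by omega) (by omega) (by omega))) 1
        rwa [show (⟨0, 1⟩ * ⟨y - b, a - x⟩ : ℤ√(-1)) + 1 * ⟨a, b⟩ = ⟨x, y⟩ from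
          Zsqrtd.ext (by simp) (by simp)] at hs
    · -- `y − x = b`: then `x + y > a` by parity, and `p = −s + (1+i)β`, `s = (a − b − x, a + b − y) ∈ 𝒮`
      have h4 : a < x + y := by
        rcases (show x + y = a ∨ a < x + y by omega) with h | h
        · exact absurd ⟨y, by omega⟩ hodd
        · exact h
      have hs := hUβ _ (hUneg _ (hS (a - b - x) (a + b - y) (by omega) (by omega) (by omega))) ⟨1, 1⟩
      rwa [show (-⟨a - b - x, a + b - y⟩ : ℤ√(-1)) + ⟨1, 1⟩ * ⟨a, b⟩ = ⟨x, y⟩ from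
        Zsqrtd.ext (by simp; ring) (by simp; ring)] at hs
    · -- `y − x > b`: `p = −i s + iβ`, `s = (a − y, x + b) ∈ 𝒮`
      have hs := hUβ _ (hUnegI _ (hS (a - y) (x + b) (by omega) (by omega) (by omega))) ⟨0, 1⟩
      rwa [show (⟨0, -1⟩ * ⟨a - y, x + b⟩ : ℤ√(-1)) + ⟨0, 1⟩ * ⟨a, b⟩ = ⟨x, y⟩ from
        Zsqrtd.ext (by simp) (by simp)] at hs
  rcases hr with ⟨h1, h2, h3, h4⟩ | ⟨h1, h2, h3, h4⟩
  · obtain ⟨x, y⟩ := r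
    exact hSq x y h1 h2 h3 h4
  · -- `T ⊆ −iS`
    obtain ⟨x, y⟩ := r
    dsimp only at h1 h2 h3 h4
    have hs := hUnegI _ (hSq (-y) x (by omega) (by omega) h1 (by omega))
    rwa [show (⟨0, -1⟩ * ⟨-y, x⟩ : ℤ√(-1)) = ⟨x, y⟩ from Zsqrtd.ext (by simp) (by simp)] at hs

/-- **Lemma 4.4 with Corollary 4.3**: under the hypotheses of `mem_of_twoSquares_of_triangle_subset`,
`U` is all of `ℤ[i]`. [cite: Graves2023, Lemma 4.4 (p. 7)] -/
theorem forall_mem_of_triangle_subset {a b : ℤ} (hab : b < a) (hb : 0 ≤ b) (hodd : ¬ 2 ∣ a + b)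
    {U : Set (ℤ√(-1))} (hUi : ∀ u ∈ U, ⟨0, 1⟩ * u ∈ U) (hUβ : ∀ u ∈ U, ∀ q : ℤ√(-1), u + q * ⟨a, b⟩ ∈ U)
    (hS : ∀ x y : ℤ, 0 ≤ x → 0 ≤ y → x + y < a → (⟨x, y⟩ : ℤ√(-1)) ∈ U) (z : ℤ√(-1)) : z ∈ U := by
  obtain ⟨r, q, rfl, hr⟩ := exists_twoSquares_add_mul hab hb z
  exact hUβ r (mem_of_twoSquares_of_triangle_subset hab hb hodd hUi hUβ hS hr) q

/-- **Lemma 4.4** as used in §5: let `B ⊆ ℤ[i]` be closed under multiplication by `i`, `a > b ≥ 0`,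
`a ≢ b (mod 2)`.  If every point of the triangle `𝒮 = {x+yi : 0 ≤ x, 0 ≤ y, x+y < a}` is congruent modulo
`a+bi` to an element of `B`, then `B ↠ ℤ[i]/(a+bi)`: every Gaussian integer is congruent to an element of `B`.
[cite: Graves2023, Lemma 4.4 (p. 7)] -/
theorem forall_exists_dvd_sub_of_triangle {a b : ℤ} (hab : b < a) (hb : 0 ≤ b) (hodd : ¬ 2 ∣ a + b)
    {B : Set (ℤ√(-1))} (hBi : ∀ r ∈ B, ⟨0, 1⟩ * r ∈ B)
    (hS : ∀ x y : ℤ, 0 ≤ x → 0 ≤ y → x + y < a → ∃ r ∈ B, (⟨a, b⟩ : ℤ√(-1)) ∣ ⟨x, y⟩ - r) (z : ℤ√(-1)) :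
    ∃ r ∈ B, (⟨a, b⟩ : ℤ√(-1)) ∣ z - r := by
  refine forall_mem_of_triangle_subset hab hb hodd (U := {u | ∃ r ∈ B, (⟨a, b⟩ : ℤ√(-1)) ∣ u - r})
    ?_ ?_ hS z
  · rintro u ⟨r, hr, hdvd⟩
    exact ⟨_, hBi r hr, by rw [← mul_sub]; exact hdvd.mul_left _⟩
  · rintro u ⟨r, hr, hdvd⟩ q
    exact ⟨r, hr, by rw [add_sub_right_comm]; exact hdvd.add (dvd_mul_left _ _)⟩

/-! ## §4 Corollary 4.3 (uniqueness): the elements of `S ∪ T` are pairwise incongruent -/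

/-- A Gaussian integer of norm `< 4` has both coordinates in `{−1, 0, 1}`. [cite: Graves2023, Lemma 4.2 (proof, p. 7)] -/
private theorem natAbs_le_one_of_norm_lt_four {z : ℤ√(-1)} (h : z.norm < 4) :
    -1 ≤ z.re ∧ z.re ≤ 1 ∧ -1 ≤ z.im ∧ z.im ≤ 1 := by
  rw [norm_def] at h
  have h1 := mul_self_nonneg z.re
  have h2 := mul_self_nonneg z.im
  refine ⟨?_, ?_, ?_, ?_⟩ <;> nlinarith

/-- **Lemmas 4.1–4.2, Corollary 4.3 (uniqueness half)**: for `a > b ≥ 0`, two elements of `S ∪ T` that are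
congruent modulo `a + bi` are equal («`Nm(z) Nm(a+bi) = (α−c)² + (β−d)² < 4 Nm(a+bi)` … so `Nm(z) = 1` or
`2` … it is easy to check that `(α+βi + C) ∩ S = ∅`»). [cite: Graves2023, Cor. 4.3 (p. 7)] -/
theorem eq_of_twoSquares_of_dvd_sub {a b : ℤ} (hab : b < a) (hb : 0 ≤ b) {r r' : ℤ√(-1)}
    (hr : (0 ≤ r.re ∧ r.re < a ∧ 0 ≤ r.im ∧ r.im < a) ∨ (0 ≤ r.re ∧ r.re < b ∧ -b ≤ r.im ∧ r.im < 0))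
    (hr' : (0 ≤ r'.re ∧ r'.re < a ∧ 0 ≤ r'.im ∧ r'.im < a) ∨ (0 ≤ r'.re ∧ r'.re < b ∧ -b ≤ r'.im ∧ r'.im < 0))
    (hdvd : (⟨a, b⟩ : ℤ√(-1)) ∣ r - r') : r = r' := by
  obtain ⟨z, hz⟩ := hdvd
  obtain ⟨x, y⟩ := r
  obtain ⟨x', y'⟩ := r'
  dsimp only at hr hr'
  have hre := congrArg Zsqrtd.re hz
  have him := congrArg Zsqrtd.im hz
  simp only [re_sub, re_mul, im_sub, im_mul] at hre him
  -- `N(z)·N(β) = (x − x')² + (y − y')² < 4 N(β)`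
  have hN : (a * a + b * b) * z.norm = (x - x') * (x - x') + (y - y') * (y - y') := by
    rw [norm_def, hre, him]; ring
  have hx1 : -(a - 1) ≤ x - x' ∧ x - x' ≤ a - 1 := by omega
  have hy1 : -(a + b - 1) ≤ y - y' ∧ y - y' ≤ a + b - 1 := by omega
  have hX : (x - x') * (x - x') ≤ (a - 1) * (a - 1) := by
    nlinarith [mul_nonneg (sub_nonneg.2 hx1.2) (by linarith : 0 ≤ a - 1 + (x - x'))]
  have hY : (y - y') * (y - y') ≤ (a + b - 1) * (a + b - 1) := by
    nlinarith [mul_nonneg (sub_nonneg.2 hy1.2) (by linarith : 0 ≤ a + b - 1 + (y - y'))]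
  have hz4 : z.norm < 4 := by
    by_contra h4
    have : (a * a + b * b) * 4 ≤ (a * a + b * b) * z.norm :=
      Int.mul_le_mul_of_nonneg_left (not_lt.mp h4) (by nlinarith)
    nlinarith
  obtain ⟨h1, h2, h3, h4⟩ := natAbs_le_one_of_norm_lt_four hz4
  obtain ⟨zr, zi⟩ := z
  dsimp only at h1 h2 h3 h4 hre him
  refine Zsqrtd.ext ?_ ?_ <;> dsimp only <;>
    interval_cases zr <;> interval_cases zi <;> omega

/-- **Corollary 4.3** in full: for `a > b ≥ 0` every Gaussian integer is congruent modulo `a+bi` to EXACTLY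
one element of `S ∪ T`. [cite: Graves2023, Cor. 4.3 (p. 7)] -/
theorem existsUnique_twoSquares {a b : ℤ} (hab : b < a) (hb : 0 ≤ b) (z : ℤ√(-1)) :
    ∃! r : ℤ√(-1), ((0 ≤ r.re ∧ r.re < a ∧ 0 ≤ r.im ∧ r.im < a) ∨ (0 ≤ r.re ∧ r.re < b ∧ -b ≤ r.im ∧ r.im < 0)) ∧
      (⟨a, b⟩ : ℤ√(-1)) ∣ z - r := by
  obtain ⟨r, q, hzr, hr⟩ := exists_twoSquares_add_mul hab hb z
  refine ⟨r, ⟨hr, q, by rw [hzr]; ring⟩, fun r' ⟨hr', hd'⟩ ↦ ?_⟩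
  refine eq_of_twoSquares_of_dvd_sub hab hb hr' hr ?_
  have h : (⟨a, b⟩ : ℤ√(-1)) ∣ z - r := ⟨q, by rw [hzr]; ring⟩
  have := dvd_sub h hd'
  rwa [sub_sub_sub_cancel_left] at this

end Literature.NumberTheory.QuadraticFields.GaussianDigits
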